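import Literature.NumberTheory.EllipticCurves.Rank1Residual.X12CubeSumTransport
import Summits.BirchSwinnertonDyer.Rank1Residual.X12.FrobeniusIrrRecords
import Summits.BirchSwinnertonDyer.Rank1Residual.X12.InertCoreInstancesA
import Summits.BirchSwinnertonDyer.Rank1Residual.X12.InertCoreInstancesB
import Summits.BirchSwinnertonDyer.Rank1Residual.X12.InertCoreInstancesF
import Summits.BirchSwinnertonDyer.Rank1Residual.X12.InertCoreInstancesG
import Summits.BirchSwinnertonDyer.Rank1Residual.X12.JZeroThreeRecordsA
import Summits.BirchSwinnertonDyer.Rank1Residual.X12.JZeroThreeRecordsB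
import Summits.BirchSwinnertonDyer.Rank1Residual.X12.JZeroThreeRecordsD
import Summits.BirchSwinnertonDyer.Rank1Residual.X12.JZeroThreeRecordsF
import Summits.BirchSwinnertonDyer.Rank1Residual.X12.JZeroThreeRecordsG
import Summits.BirchSwinnertonDyer.Rank1Residual.X12.JZeroThreeRecordsJ
import Summits.BirchSwinnertonDyer.Rank1Residual.X12.JZeroThreeRecordsK
import Summits.BirchSwinnertonDyer.BirchSwinnertonDyer.Theorems.PrintCFramTCubeGlobalDefectCard
import HarnessLib

/-!
# Route PrintCFram, regime T: `d₀ = #W(K)[3^∞] = 3` BY NAME for the 26 window T_cube classes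
# (cell `bsd-print-cfram`, seat p4 g3; display, supports stmt-BirchSwinnertonDyer-20699)

HONEST FRAMING (cell `bsd-print-cfram`, run/shared/lean/pub/bsd-print-cfram/, D-0131 (2) print
tier; verbatim in every file of the seat): the cell works the partition leaf
`CornerF ∧ p ramified in the CM field K` (LADDER-BSD row K7r = B13; W-ALL row 12r) in PARTITION
currency — a leaf or a cell counts only when its theorem is in the kernel BY NAME. Nothing is
closed here. INSTANCES of the seat's class-wide theorem `GlobalDefect.card_threePrimary_frameField_eq_three`
(`PrintCFramTCubeGlobalDefectCard.lean`): for the displayed member `W` (tree model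
`X12.Records.c<label>` / `X12CubeSum.cremona<label>`) of each of the 26 regime-T_cube classes of the
window `N < 2·10⁴` (census j284048 / j285547) and EVERY `3`-frame field `K` (`[K:ℚ] = 2`, `d_K = −3`):
`Nat.card (W(K)[3^∞]) = 3` — ty3 PART H's `d0 = 3`, planner ask «T_cube global-defect witnesses»
(INBOX 18:30:52Z) — with the three per-class inputs decided in the kernel: the Mordell datum
`C • W = y² = x³ + k`, the cube-sum witness (`k = c²` or `−3k = c²`), and `4k ∉ ℚ³` from one displayed
prime `p` with `3 ∤ v_p(4k)` (`not_exists_rat_cube_of_pow_dvd`). Records; nothing asserted about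
`L`-values or Selmer groups. beyond-print: NO.
-/

set_option linter.dupNamespace false
set_option autoImplicit false

noncomputable section

open scoped Classical
open WeierstrassCurve Literature.NumberTheory.EllipticCurves
  Literature.NumberTheory.EllipticCurves.Rank1Residual
  Literature.NumberTheory.EllipticCurves.HuShuYin2019
  Summit.BirchSwinnertonDyer.Rank1Residual Summit.BirchSwinnertonDyer.Rank1Residual.X12

namespace Summit.BirchSwinnertonDyer.BirchSwinnertonDyer.Theorems.PrintCFram.GlobalDefect

/-! ### `6075bd1` (class 6075bd; `k = 90000`, k = 300²; `3^2 ∥ 4k`) -/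

/-- Mordell datum of `6075bd1`: `C • W = y² = x³ + 90000`. [folklore] -/
theorem d0_6075bd1_mordell : halfScale • X12.Records.c6075bd1 = mordellCurve (90000 : ℚ) := by
  simp only [X12.Records.c6075bd1, halfScale_smul, mordellCurve]; norm_num

/-- **`d₀(6075bd1) = #W(K)[3^∞] = 3`** for every `3`-frame field `K` (cube-sum class 6075bd).
[cite: SilvermanAEC2009, Exercise 3.7 and III.10] -/
theorem d0_6075bd1 {K : Type} [Field K] [NumberField K] (hK2 : Module.finrank ℚ K = 2)
    (hdK : NumberField.discr K = -3) :
    Nat.card (AddCommGroup.primaryComponent ((X12.Records.c6075bd1).baseChange K).toAffine.Point 3) = 3 :=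
  card_threePrimary_frameField_eq_three hK2 hdK (by norm_num) d0_6075bd1_mordell
    (by
      haveI : Fact (Nat.Prime 3) := ⟨by norm_num⟩
      have h := not_exists_rat_cube_of_pow_dvd 3 (m := 4 * 90000) (a := 2)
        (by decide) (by decide) (by decide)
      norm_num at h ⊢
      exact h)
    (Or.inl ⟨300, by norm_num⟩)

/-! ### `7803q1` (class 7803q; `k = 1336336`, k = 1156²; `17^4 ∥ 4k`) -/

/-- Mordell datum of `7803q1`: `C • W = y² = x³ + 1336336`. [folklore] -/
theorem d0_7803q1_mordell : halfScale • X12.Records.c7803q1 = mordellCurve (1336336 : ℚ) := by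
  simp only [X12.Records.c7803q1, halfScale_smul, mordellCurve]; norm_num

/-- **`d₀(7803q1) = #W(K)[3^∞] = 3`** for every `3`-frame field `K` (cube-sum class 7803q).
[cite: SilvermanAEC2009, Exercise 3.7 and III.10] -/
theorem d0_7803q1 {K : Type} [Field K] [NumberField K] (hK2 : Module.finrank ℚ K = 2)
    (hdK : NumberField.discr K = -3) :
    Nat.card (AddCommGroup.primaryComponent ((X12.Records.c7803q1).baseChange K).toAffine.Point 3) = 3 :=
  card_threePrimary_frameField_eq_three hK2 hdK (by norm_num) d0_7803q1_mordell
    (by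
      haveI : Fact (Nat.Prime 17) := ⟨by norm_num⟩
      have h := not_exists_rat_cube_of_pow_dvd 17 (m := 4 * 1336336) (a := 4)
        (by decide) (by decide) (by decide)
      norm_num at h ⊢
      exact h)
    (Or.inl ⟨1156, by norm_num⟩)

/-! ### `7803r1` (class 7803r; `k = 4624`, k = 68²; `17^2 ∥ 4k`) -/

/-- Mordell datum of `7803r1`: `C • W = y² = x³ + 4624`. [folklore] -/
theorem d0_7803r1_mordell : halfScale • X12.Records.c7803r1 = mordellCurve (4624 : ℚ) := by
  simp only [X12.Records.c7803r1, halfScale_smul, mordellCurve]; norm_num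

/-- **`d₀(7803r1) = #W(K)[3^∞] = 3`** for every `3`-frame field `K` (cube-sum class 7803r).
[cite: SilvermanAEC2009, Exercise 3.7 and III.10] -/
theorem d0_7803r1 {K : Type} [Field K] [NumberField K] (hK2 : Module.finrank ℚ K = 2)
    (hdK : NumberField.discr K = -3) :
    Nat.card (AddCommGroup.primaryComponent ((X12.Records.c7803r1).baseChange K).toAffine.Point 3) = 3 :=
  card_threePrimary_frameField_eq_three hK2 hdK (by norm_num) d0_7803r1_mordell
    (by
      haveI : Fact (Nat.Prime 17) := ⟨by norm_num⟩
      have h := not_exists_rat_cube_of_pow_dvd 17 (m := 4 * 4624) (a := 2)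
        (by decide) (by decide) (by decide)
      norm_num at h ⊢
      exact h)
    (Or.inl ⟨68, by norm_num⟩)

/-! ### `8649a1` (class 8649a; `k = 14776336`, k = 3844²; `31^4 ∥ 4k`) -/

/-- Mordell datum of `8649a1`: `C • W = y² = x³ + 14776336`. [folklore] -/
theorem d0_8649a1_mordell : halfScale • X12.Records.c8649a1 = mordellCurve (14776336 : ℚ) := by
  simp only [X12.Records.c8649a1, halfScale_smul, mordellCurve]; norm_num

/-- **`d₀(8649a1) = #W(K)[3^∞] = 3`** for every `3`-frame field `K` (cube-sum class 8649a).
[cite: SilvermanAEC2009, Exercise 3.7 and III.10] -/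
theorem d0_8649a1 {K : Type} [Field K] [NumberField K] (hK2 : Module.finrank ℚ K = 2)
    (hdK : NumberField.discr K = -3) :
    Nat.card (AddCommGroup.primaryComponent ((X12.Records.c8649a1).baseChange K).toAffine.Point 3) = 3 :=
  card_threePrimary_frameField_eq_three hK2 hdK (by norm_num) d0_8649a1_mordell
    (by
      haveI : Fact (Nat.Prime 31) := ⟨by norm_num⟩
      have h := not_exists_rat_cube_of_pow_dvd 31 (m := 4 * 14776336) (a := 4)
        (by decide) (by decide) (by decide)
      norm_num at h ⊢
      exact h)
    (Or.inl ⟨3844, by norm_num⟩)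

/-! ### `10404f1` (class 10404f; `k = 289`, k = 17²; `2^2 ∥ 4k`) -/

/-- Mordell datum of `10404f1`: `C • W = y² = x³ + 289`. [folklore] -/
theorem d0_10404f1_mordell : (1 : VariableChange ℚ) • X12.Records.c10404f1 = mordellCurve (289 : ℚ) := by
  norm_num [one_smul, X12.Records.c10404f1, mordellCurve]

/-- **`d₀(10404f1) = #W(K)[3^∞] = 3`** for every `3`-frame field `K` (cube-sum class 10404f).
[cite: SilvermanAEC2009, Exercise 3.7 and III.10] -/
theorem d0_10404f1 {K : Type} [Field K] [NumberField K] (hK2 : Module.finrank ℚ K = 2)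
    (hdK : NumberField.discr K = -3) :
    Nat.card (AddCommGroup.primaryComponent ((X12.Records.c10404f1).baseChange K).toAffine.Point 3) = 3 :=
  card_threePrimary_frameField_eq_three hK2 hdK (by norm_num) d0_10404f1_mordell
    (by
      haveI : Fact (Nat.Prime 2) := ⟨by norm_num⟩
      have h := not_exists_rat_cube_of_pow_dvd 2 (m := 4 * 289) (a := 2)
        (by decide) (by decide) (by decide)
      norm_num at h ⊢
      exact h)
    (Or.inl ⟨17, by norm_num⟩)

/-! ### `10404g1` (class 10404g; `k = 83521`, k = 289²; `2^2 ∥ 4k`) -/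

/-- Mordell datum of `10404g1`: `C • W = y² = x³ + 83521`. [folklore] -/
theorem d0_10404g1_mordell : (1 : VariableChange ℚ) • X12.Records.c10404g1 = mordellCurve (83521 : ℚ) := by
  norm_num [one_smul, X12.Records.c10404g1, mordellCurve]

/-- **`d₀(10404g1) = #W(K)[3^∞] = 3`** for every `3`-frame field `K` (cube-sum class 10404g).
[cite: SilvermanAEC2009, Exercise 3.7 and III.10] -/
theorem d0_10404g1 {K : Type} [Field K] [NumberField K] (hK2 : Module.finrank ℚ K = 2)
    (hdK : NumberField.discr K = -3) :
    Nat.card (AddCommGroup.primaryComponent ((X12.Records.c10404g1).baseChange K).toAffine.Point 3) = 3 :=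
  card_threePrimary_frameField_eq_three hK2 hdK (by norm_num) d0_10404g1_mordell
    (by
      haveI : Fact (Nat.Prime 2) := ⟨by norm_num⟩
      have h := not_exists_rat_cube_of_pow_dvd 2 (m := 4 * 83521) (a := 2)
        (by decide) (by decide) (by decide)
      norm_num at h ⊢
      exact h)
    (Or.inl ⟨289, by norm_num⟩)

/-! ### `11907a1` (class 11907a; `k = -2352`, −3k = 84²; `3^1 ∥ 4k`) -/

/-- Mordell datum of `11907a1`: `C • W = y² = x³ + -2352`. [folklore] -/
theorem d0_11907a1_mordell : halfScale • X12.Records.c11907a1 = mordellCurve (-2352 : ℚ) := by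
  simp only [X12.Records.c11907a1, halfScale_smul, mordellCurve]; norm_num

/-- **`d₀(11907a1) = #W(K)[3^∞] = 3`** for every `3`-frame field `K` (cube-sum class 11907a).
[cite: SilvermanAEC2009, Exercise 3.7 and III.10] -/
theorem d0_11907a1 {K : Type} [Field K] [NumberField K] (hK2 : Module.finrank ℚ K = 2)
    (hdK : NumberField.discr K = -3) :
    Nat.card (AddCommGroup.primaryComponent ((X12.Records.c11907a1).baseChange K).toAffine.Point 3) = 3 :=
  card_threePrimary_frameField_eq_three hK2 hdK (by norm_num) d0_11907a1_mordell
    (by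
      haveI : Fact (Nat.Prime 3) := ⟨by norm_num⟩
      have h := not_exists_rat_cube_of_pow_dvd 3 (m := 4 * -2352) (a := 1)
        (by decide) (by decide) (by decide)
      norm_num at h ⊢
      exact h)
    (Or.inr ⟨84, by norm_num⟩)

/-! ### `11907b1` (class 11907b; `k = -115248`, −3k = 588²; `3^1 ∥ 4k`) -/

/-- Mordell datum of `11907b1`: `C • W = y² = x³ + -115248`. [folklore] -/
theorem d0_11907b1_mordell : halfScale • X12.Records.c11907b1 = mordellCurve (-115248 : ℚ) := by
  simp only [X12.Records.c11907b1, halfScale_smul, mordellCurve]; norm_num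

/-- **`d₀(11907b1) = #W(K)[3^∞] = 3`** for every `3`-frame field `K` (cube-sum class 11907b).
[cite: SilvermanAEC2009, Exercise 3.7 and III.10] -/
theorem d0_11907b1 {K : Type} [Field K] [NumberField K] (hK2 : Module.finrank ℚ K = 2)
    (hdK : NumberField.discr K = -3) :
    Nat.card (AddCommGroup.primaryComponent ((X12.Records.c11907b1).baseChange K).toAffine.Point 3) = 3 :=
  card_threePrimary_frameField_eq_three hK2 hdK (by norm_num) d0_11907b1_mordell
    (by
      haveI : Fact (Nat.Prime 3) := ⟨by norm_num⟩
      have h := not_exists_rat_cube_of_pow_dvd 3 (m := 4 * -115248) (a := 1)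
        (by decide) (by decide) (by decide)
      norm_num at h ⊢
      exact h)
    (Or.inr ⟨588, by norm_num⟩)

/-! ### `13068c1` (class 13068c; `k = 121`, k = 11²; `2^2 ∥ 4k`) -/

/-- Mordell datum of `13068c1`: `C • W = y² = x³ + 121`. [folklore] -/
theorem d0_13068c1_mordell : (1 : VariableChange ℚ) • X12.Records.c13068c1 = mordellCurve (121 : ℚ) := by
  norm_num [one_smul, X12.Records.c13068c1, mordellCurve]

/-- **`d₀(13068c1) = #W(K)[3^∞] = 3`** for every `3`-frame field `K` (cube-sum class 13068c).
[cite: SilvermanAEC2009, Exercise 3.7 and III.10] -/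
theorem d0_13068c1 {K : Type} [Field K] [NumberField K] (hK2 : Module.finrank ℚ K = 2)
    (hdK : NumberField.discr K = -3) :
    Nat.card (AddCommGroup.primaryComponent ((X12.Records.c13068c1).baseChange K).toAffine.Point 3) = 3 :=
  card_threePrimary_frameField_eq_three hK2 hdK (by norm_num) d0_13068c1_mordell
    (by
      haveI : Fact (Nat.Prime 2) := ⟨by norm_num⟩
      have h := not_exists_rat_cube_of_pow_dvd 2 (m := 4 * 121) (a := 2)
        (by decide) (by decide) (by decide)
      norm_num at h ⊢
      exact h)
    (Or.inl ⟨11, by norm_num⟩)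

/-! ### `16641a1` (class 16641a; `k = 29584`, k = 172²; `43^2 ∥ 4k`) -/

/-- Mordell datum of `16641a1`: `C • W = y² = x³ + 29584`. [folklore] -/
theorem d0_16641a1_mordell : halfScale • X12CubeSum.cremona16641a1 = mordellCurve (29584 : ℚ) := by
  simp only [X12CubeSum.cremona16641a1, halfScale_smul, mordellCurve]; norm_num

/-- **`d₀(16641a1) = #W(K)[3^∞] = 3`** for every `3`-frame field `K` (cube-sum class 16641a).
[cite: SilvermanAEC2009, Exercise 3.7 and III.10] -/
theorem d0_16641a1 {K : Type} [Field K] [NumberField K] (hK2 : Module.finrank ℚ K = 2)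
    (hdK : NumberField.discr K = -3) :
    Nat.card (AddCommGroup.primaryComponent ((X12CubeSum.cremona16641a1).baseChange K).toAffine.Point 3) = 3 :=
  card_threePrimary_frameField_eq_three hK2 hdK (by norm_num) d0_16641a1_mordell
    (by
      haveI : Fact (Nat.Prime 43) := ⟨by norm_num⟩
      have h := not_exists_rat_cube_of_pow_dvd 43 (m := 4 * 29584) (a := 2)
        (by decide) (by decide) (by decide)
      norm_num at h ⊢
      exact h)
    (Or.inl ⟨172, by norm_num⟩)

/-! ### `18252g1` (class 18252g; `k = 169`, k = 13²; `2^2 ∥ 4k`) -/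

/-- Mordell datum of `18252g1`: `C • W = y² = x³ + 169`. [folklore] -/
theorem d0_18252g1_mordell : (1 : VariableChange ℚ) • X12.Records.c18252g1 = mordellCurve (169 : ℚ) := by
  norm_num [one_smul, X12.Records.c18252g1, mordellCurve]

/-- **`d₀(18252g1) = #W(K)[3^∞] = 3`** for every `3`-frame field `K` (cube-sum class 18252g).
[cite: SilvermanAEC2009, Exercise 3.7 and III.10] -/
theorem d0_18252g1 {K : Type} [Field K] [NumberField K] (hK2 : Module.finrank ℚ K = 2)
    (hdK : NumberField.discr K = -3) :
    Nat.card (AddCommGroup.primaryComponent ((X12.Records.c18252g1).baseChange K).toAffine.Point 3) = 3 :=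
  card_threePrimary_frameField_eq_three hK2 hdK (by norm_num) d0_18252g1_mordell
    (by
      haveI : Fact (Nat.Prime 2) := ⟨by norm_num⟩
      have h := not_exists_rat_cube_of_pow_dvd 2 (m := 4 * 169) (a := 2)
        (by decide) (by decide) (by decide)
      norm_num at h ⊢
      exact h)
    (Or.inl ⟨13, by norm_num⟩)

/-! ### `18252h1` (class 18252h; `k = 114244`, k = 338²; `2^4 ∥ 4k`) -/

/-- Mordell datum of `18252h1`: `C • W = y² = x³ + 114244`. [folklore] -/
theorem d0_18252h1_mordell : (1 : VariableChange ℚ) • X12.Records.c18252h1 = mordellCurve (114244 : ℚ) := by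
  norm_num [one_smul, X12.Records.c18252h1, mordellCurve]

/-- **`d₀(18252h1) = #W(K)[3^∞] = 3`** for every `3`-frame field `K` (cube-sum class 18252h).
[cite: SilvermanAEC2009, Exercise 3.7 and III.10] -/
theorem d0_18252h1 {K : Type} [Field K] [NumberField K] (hK2 : Module.finrank ℚ K = 2)
    (hdK : NumberField.discr K = -3) :
    Nat.card (AddCommGroup.primaryComponent ((X12.Records.c18252h1).baseChange K).toAffine.Point 3) = 3 :=
  card_threePrimary_frameField_eq_three hK2 hdK (by norm_num) d0_18252h1_mordell
    (by
      haveI : Fact (Nat.Prime 2) := ⟨by norm_num⟩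
      have h := not_exists_rat_cube_of_pow_dvd 2 (m := 4 * 114244) (a := 4)
        (by decide) (by decide) (by decide)
      norm_num at h ⊢
      exact h)
    (Or.inl ⟨338, by norm_num⟩)

/-! ### `19044b1` (class 19044b; `k = 2116`, k = 46²; `2^4 ∥ 4k`) -/

/-- Mordell datum of `19044b1`: `C • W = y² = x³ + 2116`. [folklore] -/
theorem d0_19044b1_mordell : (1 : VariableChange ℚ) • X12.Records.cremona19044b1 = mordellCurve (2116 : ℚ) := by
  norm_num [one_smul, X12.Records.cremona19044b1, mordellCurve]

/-- **`d₀(19044b1) = #W(K)[3^∞] = 3`** for every `3`-frame field `K` (cube-sum class 19044b).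
[cite: SilvermanAEC2009, Exercise 3.7 and III.10] -/
theorem d0_19044b1 {K : Type} [Field K] [NumberField K] (hK2 : Module.finrank ℚ K = 2)
    (hdK : NumberField.discr K = -3) :
    Nat.card (AddCommGroup.primaryComponent ((X12.Records.cremona19044b1).baseChange K).toAffine.Point 3) = 3 :=
  card_threePrimary_frameField_eq_three hK2 hdK (by norm_num) d0_19044b1_mordell
    (by
      haveI : Fact (Nat.Prime 2) := ⟨by norm_num⟩
      have h := not_exists_rat_cube_of_pow_dvd 2 (m := 4 * 2116) (a := 4)
        (by decide) (by decide) (by decide)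
      norm_num at h ⊢
      exact h)
    (Or.inl ⟨46, by norm_num⟩)

end Summit.BirchSwinnertonDyer.BirchSwinnertonDyer.Theorems.PrintCFram.GlobalDefect

end
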